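import Summits.MatrixMultiplication.OmegaCensus.DominoZpZpConsist
import HarnessLib

/-!
# The moment-consistency route with TRIANGULAR row verdicts (coordinate-swap symmetry)

ω-census `pub-omega`, family (b3), seat pub-omega-group gen 27.  Framing: lottery ticket; floor = certified bounds/negative
ranges.  VALUE: halves the kernel work of the instances of `DominoZpZpConsist.lean` (needed for the `p = 7` cells, ≈ 40× the
`p = 5` ones); NOT progress on ω.

Swapping the two coordinates of `ℤ_p²` (`AddEquiv.prodComm`) exchanges the roles of the pivot pair `(T₀, T₁)`; since the core
theorem `no_shifted_form_of_onto_zpzp_consist_core` holds for EVERY surjection, it suffices that for each pair ONE of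
`pairDead … T₀ T₁`, `pairDead … T₁ T₀` is the kernel verdict `true`.  `triRow p M Lst L0 i` checks row `i` against the columns
`j ≥ i` only; `pairs_of_triRows` turns `∀ i < |L0|, triRow … i = true` into the symmetric pair hypothesis, and
`no_law_cube_1de_of_onto_zpzp_of_tri` / `no_law_cube_1d_e_of_onto_zpzp_of_tri` are the TPP statements.
-/

namespace Summit.MatrixMultiplication.OmegaCensus

open Finset

namespace ZpZpDomino

/-- Row `i` of the triangular check: `L0[i]` against every `L0[j]`, `j ≥ i`. [folklore] -/
def triRow (p M : ℕ) (Lst L0 : List (List ℕ × ℕ)) (i : ℕ) : Bool :=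
  (L0.drop i).all fun T₁ => pairDead p M (masksOf p M Lst) (lagTab p M) (L0.getD i ([], 0)) T₁

/-- **From triangular rows to the symmetric pair hypothesis.** [folklore] -/
theorem pairs_of_triRows {p M : ℕ} {Lst L0 : List (List ℕ × ℕ)} (h : ∀ i < L0.length, triRow p M Lst L0 i = true) :
    ∀ T₀ ∈ L0, ∀ T₁ ∈ L0, pairDead p M (masksOf p M Lst) (lagTab p M) T₀ T₁ = true ∨
      pairDead p M (masksOf p M Lst) (lagTab p M) T₁ T₀ = true := by
  intro T₀ h₀ T₁ h₁
  obtain ⟨i, hi, rfl⟩ := List.getElem_of_mem h₀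
  obtain ⟨j, hj, rfl⟩ := List.getElem_of_mem h₁
  have key : ∀ a b (ha : a < L0.length) (hb : b < L0.length), a ≤ b →
      pairDead p M (masksOf p M Lst) (lagTab p M) L0[a] L0[b] = true := by
    intro a b ha hb hab
    have hr := h a ha
    unfold triRow at hr
    rw [List.all_eq_true] at hr
    have hmem : L0[b] ∈ L0.drop a := by
      rw [List.mem_iff_getElem]
      refine ⟨b - a, by rw [List.length_drop]; omega, ?_⟩
      rw [List.getElem_drop]
      congr 1; omega
    have e : L0.getD a ([], 0) = L0[a] := by rw [List.getD_eq_getElem?_getD, List.getElem?_eq_getElem ha]; rfl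
    rw [← e]
    exact hr _ hmem
  rcases le_or_gt i j with hij | hij
  · exact Or.inl (key i j hi hj hij)
  · exact Or.inr (key j i hj hi hij.le)

section Core

variable {p : ℕ} [Fact p.Prime] {A : Type*} [AddCommGroup A] [DecidableEq A] [Fintype A]

/-- **Main theorem (shifted-form level), triangular form**: as `no_shifted_form_of_onto_zpzp_of_consist` but with the symmetric
pair hypothesis (for each pivot pair one of the two orders is a kernel verdict). [folklore] -/
theorem no_shifted_form_of_onto_zpzp_of_tri (η : ZMod p) (hη : η + η = 1) (Φ : A →+ ZMod p × ZMod p)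
    (hΦ : Function.Surjective Φ) {X Y : Finset A} {β γ x₀ : A} {d K M : ℕ} (hXd : X.card = d)
    (hA : Fintype.card A = p * K) (Lst L0 : List (List ℕ × ℕ)) (hM : 2 ≤ M ∧ M < p) (hinv : invCheck p M = true)
    (hpairs : ∀ T₀ ∈ L0, ∀ T₁ ∈ L0, pairDead p M (masksOf p M Lst) (lagTab p M) T₀ T₁ = true ∨
      pairDead p M (masksOf p M Lst) (lagTab p M) T₁ T₀ = true)
    (hcomp : ∀ F ∈ compsLB [] p d, ∀ (G : ZMod p → ℕ) (s : ZMod p),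
      (∀ τ : ZMod p, (∑ v : ZMod p, (vecFn F (τ - v) + vecFn F (v - τ) + vecFn F (τ + v)) * G v) +
        (if s = τ then 1 else 0) = K) → (F, s.val) ∈ Lst)
    (hrep : ∀ T ∈ Lst, ∃ k : ℕ, k % p ≠ 0 ∧ ∃ T' ∈ L0, T'.2 % p = k * T.2 % p ∧ ∀ v < p, T'.1.getD (k * v % p) 0 = T.1.getD v 0)
    (hinj : Set.InjOn (fun q : A × A => q.1 + q.2) ↑(X ×ˢ Y))
    (hPQ : Disjoint ((X ×ˢ Y).image fun q : A × A => q.1 + q.2)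
      (((Y ×ˢ X).image fun q : A × A => q.1 - q.2).image fun z => z + β))
    (hPR : Disjoint ((X ×ˢ Y).image fun q : A × A => q.1 + q.2)
      (((X ×ˢ Y).image fun q : A × A => q.1 - q.2).image fun z => z + γ))
    (hQR : Disjoint (((Y ×ˢ X).image fun q : A × A => q.1 - q.2).image fun z => z + β)
      (((X ×ˢ Y).image fun q : A × A => q.1 - q.2).image fun z => z + γ))
    (hcover : ((X ×ˢ Y).image fun q : A × A => q.1 + q.2) ∪
      (((Y ×ˢ X).image fun q : A × A => q.1 - q.2).image fun z => z + β) ∪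
      (((X ×ˢ Y).image fun q : A × A => q.1 - q.2).image fun z => z + γ) = univ.erase x₀) : False := by
  classical
  have hp : 0 < p := (Fact.out : p.Prime).pos
  have m0 := shadowL_mem η hη Φ hΦ hXd hA Lst hcomp hinj hPQ hPR hQR hcover (1 : ZMod p) 0 (Or.inl one_ne_zero)
  have m1 := shadowL_mem η hη Φ hΦ hXd hA Lst hcomp hinj hPQ hPR hQR hcover (0 : ZMod p) 1 (Or.inr one_ne_zero)
  obtain ⟨k₁, hk₁, T₀, hT₀, hs₀, hF₀⟩ := hrep _ m0
  obtain ⟨k₂, hk₂, T₁, hT₁, hs₁, hF₁⟩ := hrep _ m1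
  set κ₁ : ZMod p := ((k₁ : ℕ) : ZMod p) with hκ₁
  set κ₂ : ZMod p := ((k₂ : ℕ) : ZMod p) with hκ₂
  have hκ₁0 : κ₁ ≠ 0 := by
    rw [hκ₁, ne_eq, ZMod.natCast_eq_zero_iff]; exact fun hd => hk₁ (Nat.mod_eq_zero_of_dvd hd)
  have hκ₂0 : κ₂ ≠ 0 := by
    rw [hκ₂, ne_eq, ZMod.natCast_eq_zero_iff]; exact fun hd => hk₂ (Nat.mod_eq_zero_of_dvd hd)
  set D : ZMod p × ZMod p →+ ZMod p × ZMod p :=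
    (AddMonoidHom.mulLeft κ₁).prodMap (AddMonoidHom.mulLeft κ₂) with hD
  set Ψ : A →+ ZMod p × ZMod p := D.comp Φ with hΨ
  have eΨ : ∀ a, Ψ a = (κ₁ * (Φ a).1, κ₂ * (Φ a).2) := fun a => rfl
  have hΨs : Function.Surjective Ψ := by
    intro y
    obtain ⟨a, ha⟩ := hΦ (κ₁⁻¹ * y.1, κ₂⁻¹ * y.2)
    refine ⟨a, ?_⟩
    rw [eΨ, ha]
    ext <;> simp [← mul_assoc, mul_inv_cancel₀ hκ₁0, mul_inv_cancel₀ hκ₂0]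
  have eu : ∀ a, Ψ a - η • Ψ β = (κ₁ * (Φ a - η • Φ β).1, κ₂ * (Φ a - η • Φ β).2) := fun a => by
    rw [eΨ, eΨ]; ext <;> simp <;> ring
  have ew : Ψ x₀ - η • Ψ β - η • Ψ γ = (κ₁ * (Φ x₀ - η • Φ β - η • Φ γ).1, κ₂ * (Φ x₀ - η • Φ β - η • Φ γ).2) := by
    rw [eΨ, eΨ, eΨ]; ext <;> simp <;> ring
  -- the pointwise description of the coordinate shadows of `Ψ`
  have hT₀F : ∀ v : ZMod p, T₀.1.getD v.val 0 = (X.filter fun a => (Ψ a - η • Ψ β).1 = v).card := by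
    intro v
    have e1 := hF₀ (κ₁⁻¹ * v).val (ZMod.val_lt _)
    have ev : k₁ * (κ₁⁻¹ * v).val % p = v.val := by
      have : (((k₁ * (κ₁⁻¹ * v).val : ℕ)) : ZMod p) = v := by
        push_cast; rw [ZMod.natCast_zmod_val, ← hκ₁, ← mul_assoc, mul_inv_cancel₀ hκ₁0, one_mul]
      rw [← ZMod.val_natCast, this]
    rw [ev] at e1
    rw [e1, getD_shadowL]
    refine congrArg Finset.card (Finset.filter_congr fun a _ => ?_)
    rw [lmap_apply, one_mul, zero_mul, add_zero, eu]
    constructor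
    · intro e; rw [e, ← mul_assoc, mul_inv_cancel₀ hκ₁0, one_mul]
    · intro e; rw [← e, ← mul_assoc, inv_mul_cancel₀ hκ₁0, one_mul]
  have hT₀s : ((T₀.2 : ℕ) : ZMod p) = (Ψ x₀ - η • Ψ β - η • Ψ γ).1 := by
    have e := (ZMod.natCast_eq_natCast_iff' _ _ p).2 hs₀
    simp only [Nat.cast_mul, ZMod.natCast_zmod_val, lmap_apply, one_mul, zero_mul, add_zero] at e
    rw [e, ew]
  have hT₁F : ∀ v : ZMod p, T₁.1.getD v.val 0 = (X.filter fun a => (Ψ a - η • Ψ β).2 = v).card := by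
    intro v
    have e1 := hF₁ (κ₂⁻¹ * v).val (ZMod.val_lt _)
    have ev : k₂ * (κ₂⁻¹ * v).val % p = v.val := by
      have : (((k₂ * (κ₂⁻¹ * v).val : ℕ)) : ZMod p) = v := by
        push_cast; rw [ZMod.natCast_zmod_val, ← hκ₂, ← mul_assoc, mul_inv_cancel₀ hκ₂0, one_mul]
      rw [← ZMod.val_natCast, this]
    rw [ev] at e1
    rw [e1, getD_shadowL]
    refine congrArg Finset.card (Finset.filter_congr fun a _ => ?_)
    rw [lmap_apply, one_mul, zero_mul, zero_add, eu]
    constructor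
    · intro e; rw [e, ← mul_assoc, mul_inv_cancel₀ hκ₂0, one_mul]
    · intro e; rw [← e, ← mul_assoc, inv_mul_cancel₀ hκ₂0, one_mul]
  have hT₁s : ((T₁.2 : ℕ) : ZMod p) = (Ψ x₀ - η • Ψ β - η • Ψ γ).2 := by
    have e := (ZMod.natCast_eq_natCast_iff' _ _ p).2 hs₁
    simp only [Nat.cast_mul, ZMod.natCast_zmod_val, lmap_apply, one_mul, zero_mul, zero_add] at e
    rw [e, ew]
  rcases hpairs T₀ hT₀ T₁ hT₁ with hdead | hdead
  · exact no_shifted_form_of_onto_zpzp_consist_core η hη Ψ hΨs hXd hA Lst hM hinv hcomp T₀ T₁ hT₀F hT₀s hT₁F hT₁s hdead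
      hinj hPQ hPR hQR hcover
  · -- swap the coordinates
    set σ : ZMod p × ZMod p ≃+ ZMod p × ZMod p := AddEquiv.prodComm with hσ
    set Ψ' : A →+ ZMod p × ZMod p := σ.toAddMonoidHom.comp Ψ with hΨ'
    have eΨ' : ∀ a, Ψ' a = ((Ψ a).2, (Ψ a).1) := fun a => rfl
    have hΨ's : Function.Surjective Ψ' := σ.surjective.comp hΨs
    have eu' : ∀ a, Ψ' a - η • Ψ' β = ((Ψ a - η • Ψ β).2, (Ψ a - η • Ψ β).1) := fun a => by
      rw [eΨ', eΨ']; ext <;> simp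
    have ew' : Ψ' x₀ - η • Ψ' β - η • Ψ' γ = ((Ψ x₀ - η • Ψ β - η • Ψ γ).2, (Ψ x₀ - η • Ψ β - η • Ψ γ).1) := by
      rw [eΨ', eΨ', eΨ']; ext <;> simp
    refine no_shifted_form_of_onto_zpzp_consist_core η hη Ψ' hΨ's hXd hA Lst hM hinv hcomp T₁ T₀ (fun v => ?_) ?_
      (fun v => ?_) ?_ hdead hinj hPQ hPR hQR hcover
    · rw [hT₁F v]; exact congrArg Finset.card (Finset.filter_congr fun a _ => by rw [eu'])
    · rw [hT₁s, ew']
    · rw [hT₀F v]; exact congrArg Finset.card (Finset.filter_congr fun a _ => by rw [eu'])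
    · rw [hT₀s, ew']

end Core

/-! ## The TPP statements -/

section DihedralLike

open Literature.Combinatorics.Additive

variable {p : ℕ} [Fact p.Prime] {A : Type} [AddCommGroup A] [DecidableEq A] [Fintype A] {G : Type} [Group G]
  [DecidableEq G] {ρ τ : A → G} {c₀ : A} {S T U : Finset G}

/-- **No `(1,1 | d,d | e,e)` law triple over `A ↠ ℤ_p × ℤ_p` (`|A| = p·K`) from a TRIANGULAR consistency certificate for part
`d`** (dihedral-like `G`, any `c₀`, `φ` onto). [folklore] -/
theorem no_law_cube_1de_of_onto_zpzp_of_tri (η : ZMod p) (hη : η + η = 1) {d K M : ℕ}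
    (Lst L0 : List (List ℕ × ℕ)) (hM : 2 ≤ M ∧ M < p) (hinv : invCheck p M = true)
    (htri : ∀ i < L0.length, triRow p M Lst L0 i = true)
    (hcomp : ∀ F ∈ compsLB [] p d, ∀ (G : ZMod p → ℕ) (s : ZMod p),
      (∀ σ : ZMod p, (∑ v : ZMod p, (vecFn F (σ - v) + vecFn F (v - σ) + vecFn F (σ + v)) * G v) +
        (if s = σ then 1 else 0) = K) → (F, s.val) ∈ Lst)
    (hrep : ∀ T ∈ Lst, ∃ k : ℕ, k % p ≠ 0 ∧ ∃ T' ∈ L0, T'.2 % p = k * T.2 % p ∧ ∀ v < p, T'.1.getD (k * v % p) 0 = T.1.getD v 0)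
    (hρρ : ∀ a b, ρ a * ρ b = ρ (a + b)) (hρτ : ∀ a b, ρ a * τ b = τ (b - a))
    (hτρ : ∀ a b, τ a * ρ b = τ (a + b)) (hττ : ∀ a b, τ a * τ b = ρ (c₀ + b - a))
    (hρ : Function.Injective ρ) (hτ : Function.Injective τ) (hne : ∀ a b, ρ a ≠ τ b)
    (hsurj : ∀ g, (∃ a, ρ a = g) ∨ (∃ a, τ a = g))
    (φ : A →+ ZMod p × ZMod p) (hφ : Function.Surjective φ) (hA : Fintype.card A = p * K)
    (h : TripleProductProperty S T U)
    (hS₀ : (univ.filter fun a : A => ρ a ∈ S).card = 1) (hS₁ : (univ.filter fun a : A => τ a ∈ S).card = 1)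
    (hT₀ : (univ.filter fun a : A => ρ a ∈ T).card = d) (hT₁ : (univ.filter fun a : A => τ a ∈ T).card = d)
    (hU : (univ.filter fun a : A => ρ a ∈ U).card = (univ.filter fun a : A => τ a ∈ U).card)
    (hV : 3 * (S.card * T.card * U.card) + 8 = 8 * Fintype.card A) : False := by
  classical
  obtain ⟨X, Y, β, γ, x₀, hXc, -, hinj, hPQ, hPR, hQR, hcover⟩ :=
    domino_shifted_form_of_law hρρ hρτ hτρ hττ hρ hτ hne hsurj h hS₀ hS₁ (by rw [hT₀, hT₁]) hU hV
  rw [hT₀] at hXc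
  exact no_shifted_form_of_onto_zpzp_of_tri η hη φ hφ hXc hA Lst L0 hM hinv (pairs_of_triRows htri) hcomp hrep hinj hPQ
    hPR hQR hcover

/-- **No `(1,1 | d,d | e,e)` law triple over `A ↠ ℤ_p × ℤ_p` (`|A| = p·K`) from a TRIANGULAR consistency certificate for part
`e`** (the `e`-parts in `U`). [folklore] -/
theorem no_law_cube_1d_e_of_onto_zpzp_of_tri (η : ZMod p) (hη : η + η = 1) {e K M : ℕ}
    (Lst L0 : List (List ℕ × ℕ)) (hM : 2 ≤ M ∧ M < p) (hinv : invCheck p M = true)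
    (htri : ∀ i < L0.length, triRow p M Lst L0 i = true)
    (hcomp : ∀ F ∈ compsLB [] p e, ∀ (G : ZMod p → ℕ) (s : ZMod p),
      (∀ σ : ZMod p, (∑ v : ZMod p, (vecFn F (σ - v) + vecFn F (v - σ) + vecFn F (σ + v)) * G v) +
        (if s = σ then 1 else 0) = K) → (F, s.val) ∈ Lst)
    (hrep : ∀ T ∈ Lst, ∃ k : ℕ, k % p ≠ 0 ∧ ∃ T' ∈ L0, T'.2 % p = k * T.2 % p ∧ ∀ v < p, T'.1.getD (k * v % p) 0 = T.1.getD v 0)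
    (hρρ : ∀ a b, ρ a * ρ b = ρ (a + b)) (hρτ : ∀ a b, ρ a * τ b = τ (b - a))
    (hτρ : ∀ a b, τ a * ρ b = τ (a + b)) (hττ : ∀ a b, τ a * τ b = ρ (c₀ + b - a))
    (hρ : Function.Injective ρ) (hτ : Function.Injective τ) (hne : ∀ a b, ρ a ≠ τ b)
    (hsurj : ∀ g, (∃ a, ρ a = g) ∨ (∃ a, τ a = g))
    (φ : A →+ ZMod p × ZMod p) (hφ : Function.Surjective φ) (hA : Fintype.card A = p * K)
    (h : TripleProductProperty S T U)
    (hS₀ : (univ.filter fun a : A => ρ a ∈ S).card = 1) (hS₁ : (univ.filter fun a : A => τ a ∈ S).card = 1)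
    (hT : (univ.filter fun a : A => ρ a ∈ T).card = (univ.filter fun a : A => τ a ∈ T).card)
    (hU₀ : (univ.filter fun a : A => ρ a ∈ U).card = e) (hU₁ : (univ.filter fun a : A => τ a ∈ U).card = e)
    (hV : 3 * (S.card * T.card * U.card) + 8 = 8 * Fintype.card A) : False := by
  classical
  obtain ⟨X, Y, β, γ, x₀, -, hYc, hinj, hPQ, hPR, hQR, hcover⟩ :=
    domino_shifted_form_of_law hρρ hρτ hτρ hττ hρ hτ hne hsurj h hS₀ hS₁ hT (by rw [hU₀, hU₁]) hV
  rw [hU₀] at hYc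
  have himg := image_add_swap X Y
  refine no_shifted_form_of_onto_zpzp_of_tri η hη φ hφ (X := Y) (Y := X) (β := γ) (γ := β) (x₀ := x₀) hYc hA Lst L0
    hM hinv (pairs_of_triRows htri) hcomp hrep (injOn_add_swap hinj) ?_ ?_ hQR.symm ?_
  · rw [himg]; exact hPR
  · rw [himg]; exact hPQ
  · rw [himg, union_right_comm]; exact hcover

end DihedralLike

end ZpZpDomino

end Summit.MatrixMultiplication.OmegaCensus
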